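import Mathlib.LinearAlgebra.Dimension.Constructions
import Mathlib.LinearAlgebra.Dimension.Finrank
import Mathlib.Combinatorics.Enumerative.Composition
import Mathlib.RingTheory.PowerSeries.Basic
import Mathlib.Tactic.LinearCombination
import Literature.NumberTheory.Transcendental.MultipleZetaValues
import HarnessLib

/-!
# Zagier's dimension bound — proofs: the Hoffman count `d_n = #{2,3}-words of weight n`
# and the reduction of `dim_ℚ 𝒵_n ≤ d_n` to Brown's theorem

Sibling proof file of `Literature.NumberTheory.Transcendental.MultipleZetaValues` (D-0014: that
file keeps the results in print as named `Prop`s). Sorry-free content: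

* `zagierDim_eq_card_hoffman_holds` — discharge of the named fact `zagierDim_eq_card_hoffman`:
  Zagier's number `d_n` (`d₀ = 1, d₁ = 0, d₂ = 1, d_{n+3} = d_{n+1} + d_n`) is the number of
  Hoffman indices (words in the alphabet `{2, 3}`) of weight `n`. Proof as in Hoffman 1997, §1 /
  Brown 2012, §1: a Hoffman word of weight `n + 3` is `2 ∷ t` with `t` of weight `n + 1` or
  `3 ∷ t` with `t` of weight `n` (`card_hoffman_add_three`), and the weights `0, 1, 2` are
  checked by hand (`card_hoffman_zero / _one / _two`).
* `finrank_hoffmanSpan_le_zagierDim` — unconditionally, the `ℚ`-span of the Hoffman elements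
  `ζ(s)`, `s ∈ {2,3}^×` of weight `n`, has dimension `≤ d_n` (it is spanned by `d_n` vectors).
* `finrank_mzvSpace_le_zagierDim_of_hoffmanSpan_eq` — the glue: Brown's theorem
  `hoffmanSpan_eq_mzvSpace` (the Hoffman elements span `𝒵_n`; Brown 2012, Theorem 1.1, a named
  fact of the statements file, **not** discharged here) implies the Goncharov–Terasoma /
  Deligne–Goncharov bound `finrank_mzvSpace_le_zagierDim : dim_ℚ 𝒵_n ≤ d_n`.
* `zagierDim_generatingFunction` — Zagier's definition of `d_n` as printed,
  `∑ d_n tⁿ = 1 / (1 - t² - t³)`, i.e. `(1 - X² - X³) · ∑ d_n Xⁿ = 1` in `ℚ⟦X⟧` (Zagier 1994;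
  the display of Brown 2012, Lemma 2.5).
* `card_brownMonomial_eq_zagierDim` (**Brown 2012, Lemma 2.5**) and
  `zagierDim_eq_sum_filter_even_card_oddTuple` (**Terasoma 2002, Lemma 5.2**) — the *counting
  half* of the printed proofs of `dim_ℚ 𝒵_n ≤ d_n`: `d_n` is the number of monomials
  `f₂^m f_{b₁} ⋯ f_{b_r}` (`bᵢ` odd `≥ 3`, `2m + ∑ bᵢ = n`) spanning the weight-`n` piece of
  `𝒰 = ℚ⟨f₃, f₅, …⟩ ⊗ ℚ[f₂]`, equivalently `d_n = ∑_{0 ≤ a ≤ n, a even} op(n - a)` with Terasoma's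
  `op(a) = #{(b₁, b₂, …) : bᵢ odd > 1, ∑ bᵢ = a}`. (The other half — `dim L_n ≤ ∑_{a even} op(n-a)`,
  Terasoma's Lemma 5.1, resp. `𝓗 ↪ 𝓗^{MT₊} ≅ 𝒰` — is the motivic input discussed below.)

## What is deliberately NOT here

`finrank_mzvSpace_le_zagierDim` itself (Terasoma 2002, Theorem 1.2 = Main Theorem;
Deligne–Goncharov 2005, Cor. 5.25(i) with Rem. 5.26) is **not** discharged: both printed proofs,
and Brown's, go through the category of mixed Tate motives over `ℤ` (Levine's `DTM(ℚ)`, the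
identification `Ext¹(ℚ(0), ℚ(i)) = K_{2i-1}(ℚ) ⊗ ℚ` from Borel's theorem, the relative cohomology
`Hⁿ(Y⁰, j_! ℚ)` of an iterated blow-up resp. the motivic fundamental groupoid of `ℙ¹ ∖ {0,1,∞}`,
and the period map), none of which is available in Mathlib or in this tree; no proof avoiding
motives is known (whether the double-shuffle relations alone force `dim ≤ d_n` is open). The bound
therefore stays a named fact; this file records the part that is formal today and the exact
remaining input (`hoffmanSpan_eq_mzvSpace`).

## References

* M. Hoffman, *The algebra of multiple harmonic series*, J. Algebra 194 (1997), 477–495, §1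
  (the `{2,3}`-words and the recursion `d_n = d_{n-2} + d_{n-3}`). [Hoffman1997]
* F. Brown, *Mixed Tate motives over ℤ*, Ann. of Math. 175 (2012), 949–976 (arXiv:1102.1312):
  Theorem 1.1 (the Hoffman motivic MZVs are a basis; Conjecture 2 = Hoffman spanning follows by
  the period map), Lemma 2.5 (`∑ d_k t^k = 1/(1 - t² - t³)`), §8
  (`dim 𝓗_N^{2,3} = #{w ∈ {2,3}^× of weight N} = d_N`). [Brown2012]
* T. Terasoma, *Mixed Tate motives and multiple zeta values*, Invent. Math. 149 (2002),
  339–369 (arXiv:math/0104231), Theorem 1.2 (Main Theorem) `dim L_n ≤ d_n`; proof §5: Lemma 5.1,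
  the definition of `op(a)`, and Lemma 5.2 `d_n = ∑_{0 ≤ a ≤ n, a ≡ 0 (2)} op(n - a)`.
  [Terasoma2002]
* P. Deligne, A. B. Goncharov, *Groupes fondamentaux motiviques de Tate mixte*, Ann. Sci. ENS 38
  (2005), 1–56, Cor. 5.25(i) and Rem. 5.26.
-/

noncomputable section

namespace Literature.NumberTheory.Transcendental

/-! ### Hoffman indices: elementary API -/

/-- The empty index is a Hoffman index. [folklore] -/
theorem MZV.isHoffman_nil : MZV.IsHoffman [] := fun _ h => by simp at h

/-- `a ∷ t` is a Hoffman index iff `a ∈ {2, 3}` and `t` is a Hoffman index. [folklore] -/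
theorem MZV.isHoffman_cons {a : ℕ} {t : List ℕ} :
    MZV.IsHoffman (a :: t) ↔ (a = 2 ∨ a = 3) ∧ MZV.IsHoffman t := by
  simp [MZV.IsHoffman]

/-- The weight is additive on `cons`: `wt (a ∷ t) = a + wt t`. [folklore] -/
theorem MZV.weight_cons (a : ℕ) (t : List ℕ) : MZV.weight (a :: t) = a + MZV.weight t := by
  simp [MZV.weight]

/-- A nonempty Hoffman index has weight at least `2`. [folklore] -/
theorem MZV.two_le_weight_of_isHoffman_cons {a : ℕ} {t : List ℕ} (h : MZV.IsHoffman (a :: t)) :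
    2 ≤ MZV.weight (a :: t) := by
  rw [MZV.weight_cons]
  rcases (MZV.isHoffman_cons.1 h).1 with rfl | rfl <;> omega

/-- A Hoffman index of weight `0` is empty. [folklore] -/
theorem MZV.eq_nil_of_isHoffman_of_weight_eq_zero {s : List ℕ} (h : MZV.IsHoffman s)
    (hw : MZV.weight s = 0) : s = [] := by
  cases s with
  | nil => rfl
  | cons a t =>
    have := MZV.two_le_weight_of_isHoffman_cons h
    omega

/-! ### Counting Hoffman indices of a given weight -/

/-- The Hoffman indices of weight `n` form a finite type: they inject into the compositions
of `n`. [folklore] -/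
theorem finite_hoffman (n : ℕ) :
    Finite {s : List ℕ // MZV.IsHoffman s ∧ MZV.weight s = n} := by
  refine Finite.of_injective
    (fun s => (⟨s.1, fun hi => ?_, s.2.2⟩ : Composition n)) fun x y hxy => ?_
  · rcases s.2.1 _ hi with h | h <;> omega
  · exact Subtype.ext (by simpa using congrArg Composition.blocks hxy)

/-- Weight `0`: the only Hoffman index is the empty one, so the count is `1 = d₀`. [folklore] -/
theorem card_hoffman_zero :
    Nat.card {s : List ℕ // MZV.IsHoffman s ∧ MZV.weight s = 0} = 1 := by
  rw [Nat.card_eq_one_iff_exists]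
  refine ⟨⟨[], MZV.isHoffman_nil, rfl⟩, fun y => Subtype.ext ?_⟩
  exact MZV.eq_nil_of_isHoffman_of_weight_eq_zero y.2.1 y.2.2

/-- Weight `1`: there is no Hoffman index, so the count is `0 = d₁`. [folklore] -/
theorem card_hoffman_one :
    Nat.card {s : List ℕ // MZV.IsHoffman s ∧ MZV.weight s = 1} = 0 := by
  haveI : IsEmpty {s : List ℕ // MZV.IsHoffman s ∧ MZV.weight s = 1} := by
    refine ⟨fun ⟨s, hs, hw⟩ => ?_⟩
    cases s with
    | nil => simp at hw
    | cons a t =>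
      have := MZV.two_le_weight_of_isHoffman_cons hs
      omega
  exact Nat.card_of_isEmpty

/-- Weight `2`: the only Hoffman index is `(2)`, so the count is `1 = d₂`. [folklore] -/
theorem card_hoffman_two :
    Nat.card {s : List ℕ // MZV.IsHoffman s ∧ MZV.weight s = 2} = 1 := by
  rw [Nat.card_eq_one_iff_exists]
  refine ⟨⟨[2], MZV.isHoffman_cons.2 ⟨Or.inl rfl, MZV.isHoffman_nil⟩, rfl⟩, fun y => ?_⟩
  obtain ⟨s, hs, hw⟩ := y
  cases s with
  | nil => simp at hw
  | cons a t =>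
    obtain ⟨ha, ht⟩ := MZV.isHoffman_cons.1 hs
    rw [MZV.weight_cons] at hw
    have ha2 : a = 2 := by rcases ha with rfl | rfl <;> omega
    subst ha2
    have htn : t = [] := MZV.eq_nil_of_isHoffman_of_weight_eq_zero ht (by omega)
    subst htn
    rfl

/-- The recursion: a Hoffman index of weight `n + 3` is `2 ∷ t` with `wt t = n + 1` or `3 ∷ t`
with `wt t = n`, bijectively; hence `#H_{n+3} = #H_{n+1} + #H_n` (Hoffman 1997, §1). [cite: Hoffman1997, §1] -/
theorem card_hoffman_add_three (n : ℕ) :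
    Nat.card {s : List ℕ // MZV.IsHoffman s ∧ MZV.weight s = n + 3} =
      Nat.card {s : List ℕ // MZV.IsHoffman s ∧ MZV.weight s = n + 1} +
        Nat.card {s : List ℕ // MZV.IsHoffman s ∧ MZV.weight s = n} := by
  haveI := finite_hoffman (n + 1)
  haveI := finite_hoffman n
  rw [← Nat.card_sum]
  symm
  refine Nat.card_eq_of_bijective
    (Sum.elim
      (fun t => ⟨2 :: t.1, MZV.isHoffman_cons.2 ⟨Or.inl rfl, t.2.1⟩, by
        rw [MZV.weight_cons, t.2.2]; ring⟩)
      (fun t => ⟨3 :: t.1, MZV.isHoffman_cons.2 ⟨Or.inr rfl, t.2.1⟩, by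
        rw [MZV.weight_cons, t.2.2]; ring⟩))
    ⟨?_, ?_⟩
  · rintro (x | x) (y | y) hxy
    · simp only [Sum.elim_inl, Subtype.mk.injEq, List.cons.injEq, true_and] at hxy
      exact congrArg Sum.inl (Subtype.ext hxy)
    · simp only [Sum.elim_inl, Sum.elim_inr, Subtype.mk.injEq, List.cons.injEq] at hxy
      omega
    · simp only [Sum.elim_inl, Sum.elim_inr, Subtype.mk.injEq, List.cons.injEq] at hxy
      omega
    · simp only [Sum.elim_inr, Subtype.mk.injEq, List.cons.injEq, true_and] at hxy
      exact congrArg Sum.inr (Subtype.ext hxy)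
  · rintro ⟨s, hs, hw⟩
    cases s with
    | nil => simp at hw
    | cons a t =>
      obtain ⟨ha, ht⟩ := MZV.isHoffman_cons.1 hs
      rw [MZV.weight_cons] at hw
      rcases ha with rfl | rfl
      · exact ⟨Sum.inl ⟨t, ht, by omega⟩, rfl⟩
      · exact ⟨Sum.inr ⟨t, ht, by omega⟩, rfl⟩

/-- `#{Hoffman indices of weight n} = d_n` for every `n` (Hoffman 1997, §1; Brown 2012, Lemma 2.5
and §8, `dim 𝓗_N^{2,3} = #{w ∈ {2,3}^× of weight N} = d_N`). [cite: Brown2012, Lemma 2.5] -/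
theorem card_hoffman_eq_zagierDim :
    ∀ n : ℕ, Nat.card {s : List ℕ // MZV.IsHoffman s ∧ MZV.weight s = n} = zagierDim n
  | 0 => card_hoffman_zero
  | 1 => card_hoffman_one
  | 2 => card_hoffman_two
  | n + 3 => by
    rw [card_hoffman_add_three, card_hoffman_eq_zagierDim (n + 1), card_hoffman_eq_zagierDim n]
    rfl

/-- **Discharge** of the named fact `zagierDim_eq_card_hoffman` of
`Literature.NumberTheory.Transcendental.MultipleZetaValues`: Zagier's `d_n` is the number of
Hoffman indices (words in `{2, 3}`) of weight `n` (Hoffman 1997, §1; Brown 2012, Lemma 2.5: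
`∑ d_k t^k = 1/(1 - t² - t³)`, and §8: `#{w ∈ {2,3}^× of weight N} = d_N`).
[cite: Brown2012, Lemma 2.5] -/
theorem zagierDim_eq_card_hoffman_holds : zagierDim_eq_card_hoffman :=
  fun n => (card_hoffman_eq_zagierDim n).symm

/-! ### The dimension bound for the Hoffman span, and the reduction to Brown's theorem -/

/-- Unconditionally, `dim_ℚ (Hoffman span of weight n) ≤ d_n`: the Hoffman span is spanned by
the `d_n` Hoffman elements of weight `n` (Hoffman 1997, §1). [cite: Hoffman1997, §1] -/
theorem finrank_hoffmanSpan_le_zagierDim (n : ℕ) :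
    Module.finrank ℚ (hoffmanSpan n) ≤ zagierDim n := by
  haveI := finite_hoffman n
  letI : Fintype {s : List ℕ // MZV.IsHoffman s ∧ MZV.weight s = n} := Fintype.ofFinite _
  have hrange : {x : ℝ | ∃ s, MZV.IsHoffman s ∧ MZV.weight s = n ∧ x = multipleZeta s} =
      Set.range fun s : {s : List ℕ // MZV.IsHoffman s ∧ MZV.weight s = n} =>
        multipleZeta s.1 := by
    ext x
    constructor
    · rintro ⟨s, hs, hw, rfl⟩
      exact ⟨⟨s, hs, hw⟩, rfl⟩
    · rintro ⟨⟨s, hs, hw⟩, rfl⟩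
      exact ⟨s, hs, hw, rfl⟩
  calc Module.finrank ℚ (hoffmanSpan n)
      = (Set.range fun s : {s : List ℕ // MZV.IsHoffman s ∧ MZV.weight s = n} =>
          multipleZeta s.1).finrank ℚ := by
        unfold hoffmanSpan Set.finrank
        rw [hrange]
    _ ≤ Fintype.card {s : List ℕ // MZV.IsHoffman s ∧ MZV.weight s = n} :=
        finrank_range_le_card _
    _ = zagierDim n := by
        rw [← Nat.card_eq_fintype_card]
        exact card_hoffman_eq_zagierDim n

/-- **Reduction to Brown's theorem.** If the Hoffman elements span `𝒵_n` for every `n`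
(`hoffmanSpan_eq_mzvSpace`; Brown 2012, Theorem 1.1), then `dim_ℚ 𝒵_n ≤ d_n` for every `n`,
i.e. the named fact `finrank_mzvSpace_le_zagierDim` (Terasoma 2002, Theorem 1.2;
Deligne–Goncharov 2005, Cor. 5.25(i)) holds: `𝒵_n` is then spanned by `d_n` vectors
(Brown 2012, §1, deducing the Deligne–Goncharov bound together with Theorem 1.1).
[cite: Brown2012, Theorem 1.1] -/
theorem finrank_mzvSpace_le_zagierDim_of_hoffmanSpan_eq (h : hoffmanSpan_eq_mzvSpace) :
    finrank_mzvSpace_le_zagierDim := by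
  intro n
  rw [← LinearEquiv.finrank_eq (LinearEquiv.ofEq (hoffmanSpan n) (mzvSpace n) (h n))]
  exact finrank_hoffmanSpan_le_zagierDim n

/-! ### Zagier's generating function `∑ d_n tⁿ = 1 / (1 - t² - t³)` -/

section GeneratingFunction

open PowerSeries

/-- The recursion of `d_n` in generating-function form: `D = 1 + X² D + X³ D` for
`D = ∑ d_n Xⁿ ∈ ℚ⟦X⟧` (`d₀ = 1, d₁ = 0, d₂ = 1 = d₀`, `d_{n+3} = d_{n+1} + d_n`). [folklore] -/
theorem zagierDim_powerSeries_eq :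
    PowerSeries.mk (fun n => (zagierDim n : ℚ)) =
      1 + X ^ 2 * PowerSeries.mk (fun n => (zagierDim n : ℚ)) +
        X ^ 3 * PowerSeries.mk (fun n => (zagierDim n : ℚ)) := by
  ext n
  simp only [map_add, coeff_mk, coeff_one, coeff_X_pow_mul']
  match n with
  | 0 => simp [zagierDim]
  | 1 => simp [zagierDim]
  | 2 => simp [zagierDim]
  | n + 3 =>
    rw [if_neg (by omega), if_pos (by omega), if_pos (by omega),
      show n + 3 - 2 = n + 1 by omega, show n + 3 - 3 = n by omega, zero_add]
    simp [zagierDim]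

/-- **Zagier's generating function** (Zagier 1994; Brown 2012, Lemma 2.5, display): the numbers
`d_n` (`d₀ = 1, d₁ = 0, d₂ = 1, d_n = d_{n-2} + d_{n-3}`) satisfy `∑_n d_n tⁿ = 1 / (1 - t² - t³)`,
stated in `ℚ⟦X⟧` as `(1 - X² - X³) · ∑ d_n Xⁿ = 1`. [cite: Brown2012, Lemma 2.5] -/
theorem zagierDim_generatingFunction :
    (1 - X ^ 2 - X ^ 3 : PowerSeries ℚ) * PowerSeries.mk (fun n => (zagierDim n : ℚ)) = 1 := by
  linear_combination zagierDim_powerSeries_eq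

end GeneratingFunction

/-! ### Terasoma's Lemma 5.2 = Brown's Lemma 2.5: `d_n` counts the monomials `f₂^m f_{b₁} ⋯ f_{b_r}`

In the proof of his Main Theorem 1.2 (`dim L_n ≤ d_n`, the named fact
`finrank_mzvSpace_le_zagierDim`), Terasoma (2002, §5) lets `op(a)` be the number of ordered tuples
`(b₁, b₂, …)` of odd integers `bᵢ > 1` with `∑ᵢ bᵢ = a`, bounds `dim L_n` by
`∑_{0 ≤ a ≤ n, a ≡ 0 (2)} op(n - a)` (the motivic part: Lemma 5.1 and the weight filtration of
`Hⁿ(j_! ℚ_V)`), and concludes by **Lemma 5.2**: `d_n = ∑_{0 ≤ a ≤ n, a ≡ 0 (mod 2)} op(n - a)`,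
which he proves by reading off the Poincaré series
`∑_k [∑_j (∑_{i ≥ 1} t^{2i+1})^j] t^{2k} = 1 / (1 - t² - t³)` of `U = (⊕_j V^{⊗ j}) ⊗ ℚ[w]`,
`V = ⊕_{i ≥ 1} ℚ u_{2i+1}` (`deg u_i = i`, `deg w = 2`). Brown's **Lemma 2.5** (2012, §2.2) is the
same count for the comodule `𝒰 = ℚ⟨f₃, f₅, …⟩ ⊗_ℚ ℚ[f₂]` of his §2.2: `d_k := dim 𝒰_k` has
`∑ d_k t^k = 1 / (1 - t² - t³)`, "in particular `d₀ = 1, d₁ = 0, d₂ = 1` and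
`d_k = d_{k-2} + d_{k-3}` for `k ≥ 3`", the weight-`k` piece `𝒰_k` having the basis of
non-commutative monomials `f_{b₁} ⋯ f_{b_r} f₂^m` (`bᵢ` odd `≥ 3`, `2m + ∑ bᵢ = k`). This is the
counting half of the printed proofs of `dim_ℚ 𝒵_n ≤ d_n` (Terasoma; Deligne–Goncharov 2005, 5.25;
Brown); the other half is motivic and is not formalized here (see the header).

Formalization (no new definition). Terasoma's tuples of total degree `a` form the subtype
`{w : List ℕ // (∀ b ∈ w, Odd b ∧ 1 < b) ∧ w.sum = a}` — so `op(a)` is its `Nat.card` — and Brown's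
monomial basis of `𝒰_n` is `{p : ℕ × List ℕ // (∀ b ∈ p.2, Odd b ∧ 1 < b) ∧ 2 * p.1 + p.2.sum = n}`
(`p = (m, (b₁, …, b_r)) ↔ f₂^m f_{b₁} ⋯ f_{b_r}`). Instead of power series we count bijectively:
`(m, w) ↦ (m + 1, w)` on weight `n + 1` and `(m, (b₁, …)) ↦ (0, (2m + 3, b₁, …))` on weight `n`
together form a bijection onto weight `n + 3`, whence `#𝒰_{n+3} = #𝒰_{n+1} + #𝒰_n`
(`card_brownMonomial_add_three`) and `#𝒰_n = d_n` (`card_brownMonomial_eq_zagierDim`, Brown's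
Lemma 2.5); splitting off `m = 0` gives `#𝒰_{n+2} = op(n+2) + #𝒰_n` (`card_brownMonomial_add_two`)
and hence Terasoma's Lemma 5.2 (`zagierDim_eq_sum_card_oddTuple`, summed over `m = a/2`, and
`zagierDim_eq_sum_filter_even_card_oddTuple`, summed over the even `a ≤ n` exactly as printed).
-/

section TerasomaBrownCount

/-- An odd integer `b > 1` is at least `3`. [folklore] -/
theorem MZV.three_le_of_odd_of_one_lt {b : ℕ} (hb : Odd b) (hb₁ : 1 < b) : 3 ≤ b := by
  obtain ⟨k, rfl⟩ := hb
  omega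

/-- A tuple of odd integers `> 1` with sum `≤ 2` is empty. [folklore] -/
theorem MZV.eq_nil_of_forall_odd_of_sum_le_two {w : List ℕ} (hw : ∀ b ∈ w, Odd b ∧ 1 < b)
    (hs : w.sum ≤ 2) : w = [] := by
  cases w with
  | nil => rfl
  | cons b t =>
    have hb := hw b (by simp)
    have h3 := MZV.three_le_of_odd_of_one_lt hb.1 hb.2
    simp only [List.sum_cons] at hs
    omega

/-! #### Brown's monomials `f₂^m f_{b₁} ⋯ f_{b_r}` of weight `n`: the count `#𝒰_n = d_n` -/

/-- Weight `0`: the only monomial of `𝒰₀` is `1` (`m = 0`, empty word), so `#𝒰₀ = 1 = d₀`.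
[folklore] -/
theorem card_brownMonomial_zero :
    Nat.card {p : ℕ × List ℕ // (∀ b ∈ p.2, Odd b ∧ 1 < b) ∧ 2 * p.1 + p.2.sum = 0} = 1 := by
  rw [Nat.card_eq_one_iff_exists]
  refine ⟨⟨(0, []), fun _ h => by simp at h, rfl⟩, ?_⟩
  rintro ⟨⟨m, w⟩, hw, hs⟩
  have hs' : 2 * m + w.sum = 0 := hs
  obtain rfl : w = [] := MZV.eq_nil_of_forall_odd_of_sum_le_two hw (by omega)
  have hs'' : 2 * m + 0 = 0 := hs
  obtain rfl : m = 0 := by omega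
  rfl

/-- Weight `1`: `𝒰₁ = 0`, there is no monomial of weight `1`. [folklore] -/
theorem isEmpty_brownMonomial_one :
    IsEmpty {p : ℕ × List ℕ // (∀ b ∈ p.2, Odd b ∧ 1 < b) ∧ 2 * p.1 + p.2.sum = 1} := by
  refine ⟨fun p => ?_⟩
  obtain ⟨⟨m, w⟩, hw, hs⟩ := p
  have hs' : 2 * m + w.sum = 1 := hs
  obtain rfl : w = [] := MZV.eq_nil_of_forall_odd_of_sum_le_two hw (by omega)
  have hs'' : 2 * m + 0 = 1 := hs
  omega

/-- Weight `1`: `#𝒰₁ = 0 = d₁`. [folklore] -/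
theorem card_brownMonomial_one :
    Nat.card {p : ℕ × List ℕ // (∀ b ∈ p.2, Odd b ∧ 1 < b) ∧ 2 * p.1 + p.2.sum = 1} = 0 := by
  haveI := isEmpty_brownMonomial_one
  exact Nat.card_of_isEmpty

/-- Weight `2`: the only monomial of `𝒰₂` is `f₂` (`m = 1`, empty word), so `#𝒰₂ = 1 = d₂`.
[folklore] -/
theorem card_brownMonomial_two :
    Nat.card {p : ℕ × List ℕ // (∀ b ∈ p.2, Odd b ∧ 1 < b) ∧ 2 * p.1 + p.2.sum = 2} = 1 := by
  rw [Nat.card_eq_one_iff_exists]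
  refine ⟨⟨(1, []), fun _ h => by simp at h, rfl⟩, ?_⟩
  rintro ⟨⟨m, w⟩, hw, hs⟩
  have hs' : 2 * m + w.sum = 2 := hs
  obtain rfl : w = [] := MZV.eq_nil_of_forall_odd_of_sum_le_two hw (by omega)
  have hs'' : 2 * m + 0 = 2 := hs
  obtain rfl : m = 1 := by omega
  rfl

/-- The recursion behind `d_{n+3} = d_{n+1} + d_n` for Brown's monomials: `(m, w) ↦ (m + 1, w)`
(multiplication by `f₂`) on weight `n + 1` and `(m, (b₁, …)) ↦ (0, (2m + 3, b₁, …))` (trade `f₂^m`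
for a new first letter `f_{2m+3}`) on weight `n` together form a bijection onto weight `n + 3`.
[folklore] -/
theorem brownMonomial_add_three_bijective (n : ℕ) :
    Function.Bijective
      (Sum.elim
        (fun t : {p : ℕ × List ℕ // (∀ b ∈ p.2, Odd b ∧ 1 < b) ∧ 2 * p.1 + p.2.sum = n + 1} =>
          (⟨(t.1.1 + 1, t.1.2), t.2.1, by
              have _h := t.2.2
              show 2 * (t.1.1 + 1) + t.1.2.sum = n + 3
              omega⟩ :
            {p : ℕ × List ℕ // (∀ b ∈ p.2, Odd b ∧ 1 < b) ∧ 2 * p.1 + p.2.sum = n + 3}))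
        (fun t : {p : ℕ × List ℕ // (∀ b ∈ p.2, Odd b ∧ 1 < b) ∧ 2 * p.1 + p.2.sum = n} =>
          (⟨(0, (2 * t.1.1 + 3) :: t.1.2),
            fun b hb => by
              rcases List.mem_cons.1 hb with rfl | hb'
              · exact ⟨⟨t.1.1 + 1, by omega⟩, by omega⟩
              · exact t.2.1 b hb', by
              have _h := t.2.2
              show 2 * 0 + ((2 * t.1.1 + 3) :: t.1.2).sum = n + 3
              rw [List.sum_cons]
              omega⟩ :
            {p : ℕ × List ℕ // (∀ b ∈ p.2, Odd b ∧ 1 < b) ∧ 2 * p.1 + p.2.sum = n + 3}))) := by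
  constructor
  · rintro (x | x) (y | y) hxy
    · simp only [Sum.elim_inl, Subtype.mk.injEq, Prod.mk.injEq, add_left_inj] at hxy
      exact congrArg Sum.inl (Subtype.ext (Prod.ext hxy.1 hxy.2))
    · simp only [Sum.elim_inl, Sum.elim_inr, Subtype.mk.injEq, Prod.mk.injEq] at hxy
      exact absurd hxy.1 (by omega)
    · simp only [Sum.elim_inl, Sum.elim_inr, Subtype.mk.injEq, Prod.mk.injEq] at hxy
      exact absurd hxy.1 (by omega)
    · simp only [Sum.elim_inr, Subtype.mk.injEq, Prod.mk.injEq, List.cons.injEq] at hxy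
      obtain ⟨-, h₁, h₂⟩ := hxy
      exact congrArg Sum.inr (Subtype.ext (Prod.ext (by omega) h₂))
  · rintro ⟨⟨_ | m, w⟩, hw, hs⟩
    · cases w with
      | nil =>
        have hs' : 2 * 0 + 0 = n + 3 := hs
        omega
      | cons b t =>
        have hs' : 2 * 0 + (b + t.sum) = n + 3 := hs
        obtain ⟨⟨k, hk⟩, hb₁⟩ := hw b (by simp)
        refine ⟨Sum.inr ⟨(k - 1, t), fun c hc => hw c (List.mem_cons_of_mem b hc),
          show 2 * (k - 1) + t.sum = n by omega⟩, Subtype.ext ?_⟩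
        show ((0 : ℕ), (2 * (k - 1) + 3) :: t) = (0, b :: t)
        rw [show 2 * (k - 1) + 3 = b by omega]
    · have hs' : 2 * (m + 1) + w.sum = n + 3 := hs
      exact ⟨Sum.inl ⟨(m, w), hw, show 2 * m + w.sum = n + 1 by omega⟩, rfl⟩

/-- Brown's monomials of each weight form a finite type (by the recursion; weights `0, 1, 2` by
hand). [folklore] -/
theorem finite_brownMonomial :
    ∀ n : ℕ, Finite {p : ℕ × List ℕ // (∀ b ∈ p.2, Odd b ∧ 1 < b) ∧ 2 * p.1 + p.2.sum = n}
  | 0 => Nat.finite_of_card_ne_zero (by rw [card_brownMonomial_zero]; exact one_ne_zero)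
  | 1 => by haveI := isEmpty_brownMonomial_one; infer_instance
  | 2 => Nat.finite_of_card_ne_zero (by rw [card_brownMonomial_two]; exact one_ne_zero)
  | n + 3 => by
    haveI := finite_brownMonomial (n + 1)
    haveI := finite_brownMonomial n
    exact Finite.of_surjective _ (brownMonomial_add_three_bijective n).2

/-- The recursion `#𝒰_{n+3} = #𝒰_{n+1} + #𝒰_n` ("`d_k = d_{k-2} + d_{k-3}` for `k ≥ 3`",
Brown 2012, Lemma 2.5). [cite: Brown2012, Lemma 2.5] -/
theorem card_brownMonomial_add_three (n : ℕ) :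
    Nat.card {p : ℕ × List ℕ // (∀ b ∈ p.2, Odd b ∧ 1 < b) ∧ 2 * p.1 + p.2.sum = n + 3} =
      Nat.card {p : ℕ × List ℕ // (∀ b ∈ p.2, Odd b ∧ 1 < b) ∧ 2 * p.1 + p.2.sum = n + 1} +
        Nat.card {p : ℕ × List ℕ // (∀ b ∈ p.2, Odd b ∧ 1 < b) ∧ 2 * p.1 + p.2.sum = n} := by
  haveI := finite_brownMonomial (n + 1)
  haveI := finite_brownMonomial n
  rw [← Nat.card_sum]
  exact (Nat.card_eq_of_bijective _ (brownMonomial_add_three_bijective n)).symm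

/-- **Brown 2012, Lemma 2.5** (`d_k = dim 𝒰_k`, `∑ d_k t^k = 1 / (1 - t² - t³)`): for every `n`,
the number of monomials `f₂^m f_{b₁} ⋯ f_{b_r}` (`bᵢ` odd `> 1`, `2m + ∑ bᵢ = n`) — the basis of
the weight-`n` piece of `𝒰 = ℚ⟨f₃, f₅, …⟩ ⊗_ℚ ℚ[f₂]` — is Zagier's `d_n`.
[cite: Brown2012, Lemma 2.5] -/
theorem card_brownMonomial_eq_zagierDim :
    ∀ n : ℕ, Nat.card {p : ℕ × List ℕ // (∀ b ∈ p.2, Odd b ∧ 1 < b) ∧ 2 * p.1 + p.2.sum = n} =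
      zagierDim n
  | 0 => card_brownMonomial_zero
  | 1 => card_brownMonomial_one
  | 2 => card_brownMonomial_two
  | n + 3 => by
    rw [card_brownMonomial_add_three, card_brownMonomial_eq_zagierDim (n + 1),
      card_brownMonomial_eq_zagierDim n]
    rfl

/-! #### Terasoma's `op(a)` and Lemma 5.2 -/

/-- Terasoma's tuples of total degree `a` embed into Brown's monomials of weight `a`
(`w ↦ (0, w)`, i.e. `m = 0`); in particular they form a finite type. [folklore] -/
theorem finite_oddTuple (a : ℕ) :
    Finite {w : List ℕ // (∀ b ∈ w, Odd b ∧ 1 < b) ∧ w.sum = a} := by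
  haveI := finite_brownMonomial a
  refine Finite.of_injective
    (fun w => (⟨(0, w.1), w.2.1, by have _h := w.2.2; show 2 * 0 + w.1.sum = a; omega⟩ :
      {p : ℕ × List ℕ // (∀ b ∈ p.2, Odd b ∧ 1 < b) ∧ 2 * p.1 + p.2.sum = a})) ?_
  intro x y hxy
  simp only [Subtype.mk.injEq, Prod.mk.injEq, true_and] at hxy
  exact Subtype.ext hxy

/-- `op(0) = 1`: the empty tuple. [folklore] -/
theorem card_oddTuple_zero :
    Nat.card {w : List ℕ // (∀ b ∈ w, Odd b ∧ 1 < b) ∧ w.sum = 0} = 1 := by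
  rw [Nat.card_eq_one_iff_exists]
  refine ⟨⟨[], fun _ h => by simp at h, rfl⟩, ?_⟩
  rintro ⟨w, hw, hs⟩
  obtain rfl : w = [] := MZV.eq_nil_of_forall_odd_of_sum_le_two hw (by omega)
  rfl

/-- `op(1) = 0`: no tuple of odd integers `> 1` has sum `1`. [folklore] -/
theorem card_oddTuple_one :
    Nat.card {w : List ℕ // (∀ b ∈ w, Odd b ∧ 1 < b) ∧ w.sum = 1} = 0 := by
  haveI : IsEmpty {w : List ℕ // (∀ b ∈ w, Odd b ∧ 1 < b) ∧ w.sum = 1} := by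
    refine ⟨fun x => ?_⟩
    obtain ⟨w, hw, hs⟩ := x
    obtain rfl : w = [] := MZV.eq_nil_of_forall_odd_of_sum_le_two hw (by omega)
    exact absurd hs (by simp)
  exact Nat.card_of_isEmpty

/-- Splitting off `m = 0`: a monomial of weight `n + 2` is either a pure word `f_{b₁} ⋯ f_{b_r}`
(`m = 0`: one of Terasoma's `op(n + 2)` tuples) or `f₂` times a monomial of weight `n`,
bijectively. [folklore] -/
theorem brownMonomial_add_two_bijective (n : ℕ) :
    Function.Bijective
      (Sum.elim
        (fun w : {w : List ℕ // (∀ b ∈ w, Odd b ∧ 1 < b) ∧ w.sum = n + 2} =>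
          (⟨(0, w.1), w.2.1, by have _h := w.2.2; show 2 * 0 + w.1.sum = n + 2; omega⟩ :
            {p : ℕ × List ℕ // (∀ b ∈ p.2, Odd b ∧ 1 < b) ∧ 2 * p.1 + p.2.sum = n + 2}))
        (fun t : {p : ℕ × List ℕ // (∀ b ∈ p.2, Odd b ∧ 1 < b) ∧ 2 * p.1 + p.2.sum = n} =>
          (⟨(t.1.1 + 1, t.1.2), t.2.1, by
              have _h := t.2.2
              show 2 * (t.1.1 + 1) + t.1.2.sum = n + 2
              omega⟩ :
            {p : ℕ × List ℕ // (∀ b ∈ p.2, Odd b ∧ 1 < b) ∧ 2 * p.1 + p.2.sum = n + 2}))) := by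
  constructor
  · rintro (x | x) (y | y) hxy
    · simp only [Sum.elim_inl, Subtype.mk.injEq, Prod.mk.injEq] at hxy
      exact congrArg Sum.inl (Subtype.ext hxy.2)
    · simp only [Sum.elim_inl, Sum.elim_inr, Subtype.mk.injEq, Prod.mk.injEq] at hxy
      exact absurd hxy.1 (by omega)
    · simp only [Sum.elim_inl, Sum.elim_inr, Subtype.mk.injEq, Prod.mk.injEq] at hxy
      exact absurd hxy.1 (by omega)
    · simp only [Sum.elim_inr, Subtype.mk.injEq, Prod.mk.injEq, add_left_inj] at hxy
      exact congrArg Sum.inr (Subtype.ext (Prod.ext hxy.1 hxy.2))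
  · rintro ⟨⟨_ | m, w⟩, hw, hs⟩
    · have hs' : 2 * 0 + w.sum = n + 2 := hs
      exact ⟨Sum.inl ⟨w, hw, by omega⟩, rfl⟩
    · have hs' : 2 * (m + 1) + w.sum = n + 2 := hs
      exact ⟨Sum.inr ⟨(m, w), hw, show 2 * m + w.sum = n by omega⟩, rfl⟩

/-- `#𝒰_{n+2} = op(n + 2) + #𝒰_n` (split off the monomials without `f₂`). [folklore] -/
theorem card_brownMonomial_add_two (n : ℕ) :
    Nat.card {p : ℕ × List ℕ // (∀ b ∈ p.2, Odd b ∧ 1 < b) ∧ 2 * p.1 + p.2.sum = n + 2} =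
      Nat.card {w : List ℕ // (∀ b ∈ w, Odd b ∧ 1 < b) ∧ w.sum = n + 2} +
        Nat.card {p : ℕ × List ℕ // (∀ b ∈ p.2, Odd b ∧ 1 < b) ∧ 2 * p.1 + p.2.sum = n} := by
  haveI := finite_oddTuple (n + 2)
  haveI := finite_brownMonomial n
  rw [← Nat.card_sum]
  exact (Nat.card_eq_of_bijective _ (brownMonomial_add_two_bijective n)).symm

/-- **Terasoma 2002, Lemma 5.2**, summed over `m = a / 2`: `d_n = ∑_{0 ≤ m ≤ n/2} op(n - 2m)`,
where `op(a)` is the number of ordered tuples `(b₁, b₂, …)` of odd integers `bᵢ > 1` with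
`∑ bᵢ = a`. [cite: Terasoma2002, Lemma 5.2] -/
theorem zagierDim_eq_sum_card_oddTuple :
    ∀ n : ℕ, zagierDim n = ∑ m ∈ Finset.range (n / 2 + 1),
      Nat.card {w : List ℕ // (∀ b ∈ w, Odd b ∧ 1 < b) ∧ w.sum = n - 2 * m}
  | 0 => by simp [card_oddTuple_zero, zagierDim]
  | 1 => by simp [card_oddTuple_one, zagierDim]
  | n + 2 => by
    have hsum : ∑ m ∈ Finset.range (n / 2 + 1),
        Nat.card {w : List ℕ // (∀ b ∈ w, Odd b ∧ 1 < b) ∧ w.sum = n + 2 - 2 * (m + 1)} =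
        ∑ m ∈ Finset.range (n / 2 + 1),
          Nat.card {w : List ℕ // (∀ b ∈ w, Odd b ∧ 1 < b) ∧ w.sum = n - 2 * m} :=
      Finset.sum_congr rfl fun m _ => by rw [show n + 2 - 2 * (m + 1) = n - 2 * m by omega]
    rw [show (n + 2) / 2 + 1 = n / 2 + 1 + 1 by omega, Finset.sum_range_succ', hsum,
      ← zagierDim_eq_sum_card_oddTuple n, Nat.mul_zero, Nat.sub_zero,
      ← card_brownMonomial_eq_zagierDim (n + 2), ← card_brownMonomial_eq_zagierDim n,
      card_brownMonomial_add_two, add_comm]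

/-- **Terasoma 2002, Lemma 5.2** (as printed): `d_n = ∑_{0 ≤ a ≤ n, a ≡ 0 (mod 2)} op(n - a)`,
where `d_n` is Zagier's number (`d₀ = 1, d₁ = 0, d₂ = 1, d_{i+3} = d_{i+1} + d_i`) and `op(a)` is
the cardinality of the set of ordered tuples `(b₁, b₂, …)` of odd integers `bᵢ > 1` with
`∑ bᵢ = a` (Terasoma 2002, §5). This is the counting step that turns the motivic bound
`dim L_n ≤ ∑_{a even} op(n - a)` into the Main Theorem 1.2, `dim L_n ≤ d_n`
(`finrank_mzvSpace_le_zagierDim`). [cite: Terasoma2002, Lemma 5.2] -/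
theorem zagierDim_eq_sum_filter_even_card_oddTuple (n : ℕ) :
    zagierDim n = ∑ a ∈ (Finset.range (n + 1)).filter Even,
      Nat.card {w : List ℕ // (∀ b ∈ w, Odd b ∧ 1 < b) ∧ w.sum = n - a} := by
  have himage : (Finset.range (n + 1)).filter Even =
      (Finset.range (n / 2 + 1)).image (fun m => 2 * m) := by
    ext a
    simp only [Finset.mem_filter, Finset.mem_range, Finset.mem_image]
    constructor
    · rintro ⟨ha, k, rfl⟩
      exact ⟨k, by omega, by omega⟩
    · rintro ⟨m, hm, rfl⟩
      exact ⟨by omega, m, by omega⟩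
  rw [himage, Finset.sum_image fun x _ y _ h => Nat.eq_of_mul_eq_mul_left (by omega) h,
    zagierDim_eq_sum_card_oddTuple n]

end TerasomaBrownCount

end Literature.NumberTheory.Transcendental
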